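import Summits.ABC.IUTFork.Cor312LicenceShallowRealising
import Summits.ABC.IUTFork.Cor312ProvKRamified
import Literature.IUT.LogVolume.GenuineRamificationBounds
import HarnessLib

/-!
# [IUTchIII] Cor. 3.12, branch C — the INHABITED tame-shallow licence locus at GENUINE `K`-level data:
# it forces `p_w ≥ l + 2` and `(l⋆)²·ord_v(q_v) ≤ 2l·e(v|p) + 1`, hence `l ≤ 8·e(v|p) + 1 ≤ 8·[F:ℚ] + 1`, at every bad place

PROOF-ONLY record file (no `def`, no new `Prop`, no instance) of the abc-iut cell (WAVE-5 prover seat abc-iut-w5-d009, gen 9;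
self-named row «GENUINE-WINDOW-SMALL-L»). TAKES NO SIDE on [IUTchIII] Cor. 3.12 or on any author.

CONTEXT. abc-iut-w5-d236's `Cor312LicenceShallowRealising.lean` (p439445 ✓ / p440064 ✓) proves that, in the cell's typed sharp real
settings, the (xi-f) licence / branch C's hull-level antecedent is INHABITED for realising ideles on the TAME SHALLOW DEGREE LOCUS
`htame : ∀ v ∈ X.S, 2 < p_v ∧ e_v ≤ p_v − 2`, `hdeg : ∀ v ∈ X.S, 1 ≤ P_q(v) ∧ (l⋆)²·P_q(v) < e_v + 1` of an ABSTRACT Dupuy–Hilado pilot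
datum `X : PilotData F`, and records in its docstring: «Whether GENUINE initial Θ-data (K-level provenance, abc-iut-C-cert-3 v5K) meet
the locus is NOT claimed here». This file reads the two hypotheses at the GENUINE `K`-level pilot datum of a collection of initial
Θ-data `D` ([IUTchI] Def. 3.1), `X := Cor312Prov.pilotDataOfK D K` (abc-iut-C-cert-3, `Cor312ProvK.lean`: `S` = the primes `w` of
`K = F(E_F[l])` over `𝕍(F)^bad`, `ord_w(q) = e(w|v)·ord_v(q_v)`, `P_q(w) = ord_w(q)/(2l)`), using only landed theorems:
[IUTchI] Ex. 3.2 (iv) `2l ∣ ord_w(q)` (`twoMulLDvdOrdq_pilotDataOfK`), Def. 3.1 (c) `l ∤ ord_v(q_v)` ⟹ `l ∣ e(w|v)`, `e(w|p) ≥ l`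
(abc-iut-w5-d054 `Cor312ProvKRamified.lean` p436520 ✓), the tower `e(w|p) = e(v|p)·e(w|v)` and `e(v|p) ≤ [F : ℚ]`.

WHAT IS PROVED (namespace `Summit.ABC.IUTFork.Cor312Prov`; `w ∈ X.S`, `v := w ∩ 𝓞_F`, `p = p_w`; all elementary):
* `one_le_qPilot_pilotDataOfK` — **`1 ≤ P_q(w)` holds AUTOMATICALLY** (`2l ∣ ord_w(q) > 0`): the first clause of `hdeg` is free at
  genuine data;
* `l_add_two_le_residueChar_of_tame_pilotDataOfK` — the TAME clause `e_w ≤ p_w − 2` forces **`l + 2 ≤ p_w`** (`e_w = e(w|p) ≥ l`): bad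
  places of residue characteristic `≤ l + 1` are never tame at genuine data;
* `lstar_sq_mul_qParamOrd_le_of_degree_window_pilotDataOfK` — the DEGREE-WINDOW clause `(l⋆)²·P_q(w) < e_w + 1` forces
  **`(l⋆)²·ord_v(q_v) ≤ 2l·e(v|p) + 1`** (divide `e(w|v) ≥ l` out of `(l⋆)²·e(w|v)·ord_v(q_v) < 2l·(e(v|p)·e(w|v) + 1)`);
* `lstar_le_four_mul_ramIdx_of_degree_window_pilotDataOfK`, `l_le_of_degree_window_pilotDataOfK` — hence **`l⋆ ≤ 4·e(v|p)`**, i.e.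
  **`l ≤ 8·e(v|p) + 1`**, and `l_le_finrank_of_degree_window_pilotDataOfK` — **`l ≤ 8·[F : ℚ] + 1`**;
* `degree_window_pilotDataOfK_iff` — the EXACT integer dictionary of the degree-window clause at `w`:
  `(l⋆)²·P_q(w) < e_w + 1 ⟺ (l⋆)²·e(w|v)·ord_v(q_v) < 2l·(e(v|p)·e(w|v) + 1)`;
* `genuine_necessary_of_shallow_locus_pilotDataOfK` — the conjunction, in the LITERAL hypothesis shape (`htame`, `hdeg`) of
  `Thm311.Real.licence_settingPrVolSharp_of_realises_shallow` at `X := pilotDataOfK D K`, for every `w ∈ X.S`; and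
  `l_le_of_shallow_locus_pilotDataOfK_of_mem_VFbad` — the `F`-place form: `l ≤ 8·e(v|p) + 1` at EVERY `v ∈ 𝕍(F)^bad`.

READING (numbers, not adjectives; nothing about print): at genuine `K`-level data the INHABITED one-factor locus of p439445 is EMPTY as soon
as `l > 8·e(v|p) + 1` for ONE bad place `v` of `F` (a fortiori for `l > 8·[F:ℚ] + 1`); e.g. over a bad place with `e(v|p) = 1` only
`l ∈ {5, 7}` can meet it (`l⋆ ≤ 4`), with `(l⋆)²·ord_v(q_v) ≤ 2l + 1`, i.e. `ord_v(q_v) ≤ 2` (`l = 5`) resp. `ord_v(q_v) = 1` (`l = 7`),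
and then only at bad primes `p ≥ l + 2`. The complementary DEEP side at genuine data is abc-iut-C-cert-1's «HEX-KERNEL» programme
(`Conditional/AbcOfSGenuineKChosenDepth*.lean`); the strip between the two is decided by neither (abc-iut-w4-d026 p439692, abc-iut-w5-d180).
Whether some collection of initial Θ-data actually MEETS the locus is NOT claimed here (it needs `l ≤ 8·e(v|p)+1`, which the
admissibility conditions of [IUTchIV] Cor. 2.2 used by the branch-C certificates exclude for large heights — not analysed here).
HONEST SCOPE as in the companions: OUR sharp containers and Dupuy–Hilado's typed (Ind2); the licence is a STRONGER-THAN-PRINT form;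
nothing about the printed GLOBAL inequality; nothing asserts or refutes [IUTchIII] Cor. 3.12; typed ≠ proved; instantiated ≠ endorsed.
[cite: Mochizuki2012, IUTchI Def. 3.1 (b),(c) pp. 61–62; Ex. 3.2 (iv) p. 71] [cite: DupuyHilado2025, §3.3, §3.4]
[cite: NeukirchANT1999, Ch. I §8 Prop. (8.2); Ch. II Prop. (6.8)] [claim: Mochizuki2012, status: disputed] for every IUT sentence quoted.
-/

noncomputable section

open NumberField IsDedekindDomain

namespace Summit.ABC.IUTFork.Cor312Prov

open Literature.IUT.LogVolume Literature.IUT.HodgeTheaters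

variable {F K Fbar : Type} [Field F] [NumberField F] [Field K] [NumberField K] [Algebra F K] [Field Fbar]
  [Algebra F Fbar] [Algebra K Fbar] {E : WeierstrassCurve F} [E.IsElliptic] {l : ℕ} {Pb : BadPlacePredicates K}
  (D : InitialThetaData F K Fbar E l Pb)

/-! ## §1. Bookkeeping at a bad place `w` of the `K`-level datum: `e(w|v) ≥ l`, `ord_v(q_v) ≥ 1`, `e(w|p) = e(v|p)·e(w|v)` -/

/-- `l ≤ e(w|v)` at `w ∈ S` (abc-iut-w5-d054's `l ∣ e(w|v)`, and `e(w|v) ≠ 0`). [cite: Mochizuki2012, IUTchI Ex. 3.2 (iv) p. 71] -/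
theorem l_le_ramificationIdx'_of_mem_S_pilotDataOfK {w : HeightOneSpectrum (𝓞 K)} (hS : w ∈ (pilotDataOfK D K).S) :
    l ≤ (finBelow F K w).asIdeal.ramificationIdx' w.asIdeal :=
  Nat.le_of_dvd (Nat.pos_of_ne_zero (ramificationIdx'_finBelow_ne_zero (F := F) K w))
    (l_dvd_ramificationIdx'_of_over_VFbad D w ((mem_pilotDataOfK_S_iff D K w).mp hS))

/-- `1 ≤ ord_v(q_v)` (as a natural number, abc-iut-L5-t2's `qParamOrd`) below `w ∈ S`: `0 < ord_w(q) = e(w|v)·ord_v(q_v)`.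
[cite: DupuyHilado2025, §3.3] -/
theorem one_le_qParamOrd_of_mem_S_pilotDataOfK {w : HeightOneSpectrum (𝓞 K)} (hS : w ∈ (pilotDataOfK D K).S) :
    1 ≤ qParamOrd E (finBelow F K w) := by
  have hpos := (pilotDataOfK D K).ordq_pos hS
  rw [ordq_pilotDataOfK D K hS] at hpos
  by_contra h
  have h0 : qParamOrd E (finBelow F K w) = 0 := by omega
  rw [h0] at hpos
  simp at hpos

/-- The tower identity in the cell's currency: `ramIdx K w = ramIdx F v · e(w|v)` (`e(w|p) = e(v|p)·e(w|v)`, abc-iut-S-d1's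
`Thm110StepIII.ramificationIdx_int_mul_ramificationIdx'`, `ramIdx_eq`). [cite: NeukirchANT1999, Ch. II Prop. (6.8)] -/
theorem ramIdx_eq_ramIdx_finBelow_mul (w : HeightOneSpectrum (𝓞 K)) :
    ramIdx K w = ramIdx F (finBelow F K w) * (finBelow F K w).asIdeal.ramificationIdx' w.asIdeal := by
  have hmem : w.asIdeal ∈ IsDedekindDomain.primesOverFinset (finBelow F K w).asIdeal (𝓞 K) :=
    (IsDedekindDomain.mem_primesOverFinset_iff (finBelow F K w).ne_bot _).mpr ⟨w.isPrime, liesOver_finBelow F K w⟩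
  rw [ramIdx_eq K w, ramIdx_eq F (finBelow F K w)]
  exact (Thm110StepIII.ramificationIdx_int_mul_ramificationIdx' (finBelow F K w) hmem).symm

/-- `P_q(w) = e(w|v)·ord_v(q_v)/(2l)` at `w ∈ S` (Dupuy–Hilado §3.3 coefficient, `qPilot_apply_of_mem` + `ordq_pilotDataOfK`).
[cite: DupuyHilado2025, §3.3] -/
theorem qPilot_pilotDataOfK_eq {w : HeightOneSpectrum (𝓞 K)} (hS : w ∈ (pilotDataOfK D K).S) :
    (pilotDataOfK D K).qPilot w =
      (((finBelow F K w).asIdeal.ramificationIdx' w.asIdeal : ℕ) : ℝ) * (qParamOrd E (finBelow F K w) : ℝ) / (2 * (l : ℝ)) := by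
  rw [(pilotDataOfK D K).qPilot_apply_of_mem hS, ordq_pilotDataOfK D K hS, pilotDataOfK_l]
  push_cast
  ring

/-! ## §2. `1 ≤ P_q(w)` is automatic at genuine data -/

/-- **`1 ≤ P_q(w)` at every bad place of the GENUINE `K`-level datum** — the first clause of the degree-locus hypothesis `hdeg` of
`Thm311.Real.licence_settingPrVolSharp_of_realises_shallow` holds for free: `2l ∣ ord_w(q)` ([IUTchI] Ex. 3.2 (iv),
`twoMulLDvdOrdq_pilotDataOfK`) and `ord_w(q) > 0`, so `P_q(w) = ord_w(q)/(2l) ∈ ℤ_{≥ 1}`. [cite: Mochizuki2012, IUTchI Ex. 3.2 (iv) p. 71]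
[cite: DupuyHilado2025, §3.3] -/
theorem one_le_qPilot_pilotDataOfK {w : HeightOneSpectrum (𝓞 K)} (hS : w ∈ (pilotDataOfK D K).S) :
    1 ≤ (pilotDataOfK D K).qPilot w := by
  have hpos := (pilotDataOfK D K).ordq_pos hS
  have hdvd := twoMulLDvdOrdq_pilotDataOfK D w hS
  have hle : 2 * ((pilotDataOfK D K).l : ℤ) ≤ (pilotDataOfK D K).ordq w := Int.le_of_dvd hpos hdvd
  have hl0 : (0 : ℝ) < 2 * ((pilotDataOfK D K).l : ℝ) := (pilotDataOfK D K).two_mul_l_pos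
  rw [(pilotDataOfK D K).qPilot_apply_of_mem hS, le_div_iff₀ hl0, one_mul]
  exact_mod_cast hle

/-! ## §3. The tame clause forces `p_w ≥ l + 2` -/

/-- **The TAME clause `e_w ≤ p_w − 2` forces `l + 2 ≤ p_w`** at a bad place of the genuine `K`-level datum: `e_w = e(w|p) ≥ l ≥ 5`
(abc-iut-w5-d054 `l_le_ramificationIdx_int_of_over_VFbad`). So the tame-shallow locus never contains a bad place of residue
characteristic `≤ l + 1`. [cite: Mochizuki2012, IUTchI Def. 3.1 (c) p. 62; Ex. 3.2 (iv) p. 71] [cite: NeukirchANT1999, Ch. II Prop. (6.8)] -/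
theorem l_add_two_le_residueChar_of_tame_pilotDataOfK {w : HeightOneSpectrum (𝓞 K)} (hS : w ∈ (pilotDataOfK D K).S)
    (htame : ramIdx K w ≤ residueChar K w - 2) : l + 2 ≤ residueChar K w := by
  have hl : l ≤ w.asIdeal.ramificationIdx ℤ :=
    l_le_ramificationIdx_int_of_over_VFbad D w ((mem_pilotDataOfK_S_iff D K w).mp hS)
  rw [← ramIdx_eq K w] at hl
  have h5 := D.five_le_l
  omega

/-! ## §4. The degree-window clause forces `(l⋆)²·ord_v(q_v) ≤ 2l·e(v|p) + 1`, hence `l ≤ 8·e(v|p) + 1` -/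

/-- **The DEGREE-WINDOW clause `(l⋆)²·P_q(w) < e_w + 1` forces `(l⋆)²·ord_v(q_v) ≤ 2l·e(v|p) + 1`** (`v = w ∩ 𝓞_F`): with
`P_q(w) = e(w|v)·ord_v(q_v)/(2l)` and `e_w = e(v|p)·e(w|v)` the clause reads `(l⋆)²·e(w|v)·ord_v(q_v) < 2l·e(v|p)·e(w|v) + 2l`; were
`(l⋆)²·ord_v(q_v) ≥ 2l·e(v|p) + 2`, the left side would exceed the right by `≥ 2·e(w|v) − 2l ≥ 0` (`e(w|v) ≥ l`).
[cite: Mochizuki2012, IUTchI Def. 3.1 (c) p. 62; Ex. 3.2 (iv) p. 71] [cite: DupuyHilado2025, §3.3, §3.4] -/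
theorem lstar_sq_mul_qParamOrd_le_of_degree_window_pilotDataOfK {w : HeightOneSpectrum (𝓞 K)}
    (hS : w ∈ (pilotDataOfK D K).S)
    (hdeg : (((pilotDataOfK D K).lstar : ℕ) : ℝ) ^ 2 * (pilotDataOfK D K).qPilot w < (ramIdx K w : ℝ) + 1) :
    (pilotDataOfK D K).lstar ^ 2 * qParamOrd E (finBelow F K w) ≤ 2 * l * ramIdx F (finBelow F K w) + 1 := by
  set s : ℕ := (pilotDataOfK D K).lstar with hs
  set e : ℕ := (finBelow F K w).asIdeal.ramificationIdx' w.asIdeal with he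
  set q : ℕ := qParamOrd E (finBelow F K w) with hq
  set b : ℕ := ramIdx F (finBelow F K w) with hb
  have hle : l ≤ e := l_le_ramificationIdx'_of_mem_S_pilotDataOfK D hS
  have h5 : 5 ≤ l := D.five_le_l
  rw [qPilot_pilotDataOfK_eq D hS, ramIdx_eq_ramIdx_finBelow_mul (F := F) w] at hdeg
  -- `hdeg : s² · (e·q/(2l)) < b·e + 1` in `ℝ`
  have hl0 : (0 : ℝ) < 2 * (l : ℝ) := by positivity
  have hmain : ((s : ℕ) : ℝ) ^ 2 * ((e : ℝ) * (q : ℝ)) < 2 * (l : ℝ) * ((b : ℝ) * (e : ℝ) + 1) := by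
    have h := hdeg
    rw [← mul_div_assoc, div_lt_iff₀ hl0] at h
    push_cast at h
    linarith
  by_contra hc
  rw [not_le] at hc
  have hc' : (2 * (l : ℝ) * b + 2) ≤ ((s : ℕ) : ℝ) ^ 2 * (q : ℝ) := by exact_mod_cast hc
  have he0 : (0 : ℝ) ≤ (e : ℝ) := by positivity
  have hle' : (l : ℝ) ≤ (e : ℝ) := by exact_mod_cast hle
  have h1 : (2 * (l : ℝ) * b + 2) * (e : ℝ) ≤ ((s : ℕ) : ℝ) ^ 2 * (q : ℝ) * (e : ℝ) :=
    mul_le_mul_of_nonneg_right hc' he0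
  have h2 : ((s : ℕ) : ℝ) ^ 2 * (q : ℝ) * (e : ℝ) = ((s : ℕ) : ℝ) ^ 2 * ((e : ℝ) * (q : ℝ)) := by ring
  rw [h2] at h1
  nlinarith

/-- **Hence `l⋆ ≤ 4·e(v|p)`**: `ord_v(q_v) ≥ 1` gives `(l⋆)² ≤ 2l·e(v|p) + 1 = (2l⋆+1)·2e(v|p) + 1`, and `l⋆ ≥ 4e(v|p) + 1` would force
`(l⋆)² ≥ 4e(v|p)·l⋆ + l⋆ > 4e(v|p)·l⋆ + 2e(v|p) + 1` (`e(v|p) ≥ 1`). [cite: DupuyHilado2025, §3.3] -/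
theorem lstar_le_four_mul_ramIdx_of_degree_window_pilotDataOfK {w : HeightOneSpectrum (𝓞 K)}
    (hS : w ∈ (pilotDataOfK D K).S)
    (hdeg : (((pilotDataOfK D K).lstar : ℕ) : ℝ) ^ 2 * (pilotDataOfK D K).qPilot w < (ramIdx K w : ℝ) + 1) :
    (pilotDataOfK D K).lstar ≤ 4 * ramIdx F (finBelow F K w) := by
  have h := lstar_sq_mul_qParamOrd_le_of_degree_window_pilotDataOfK D hS hdeg
  have hq : 1 ≤ qParamOrd E (finBelow F K w) := one_le_qParamOrd_of_mem_S_pilotDataOfK D hS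
  have hb : 1 ≤ ramIdx F (finBelow F K w) := Nat.one_le_iff_ne_zero.mpr (ramIdx_ne_zero F (finBelow F K w))
  have hl : l = 2 * (pilotDataOfK D K).lstar + 1 := (pilotDataOfK D K).l_eq
  set s := (pilotDataOfK D K).lstar
  set q := qParamOrd E (finBelow F K w)
  set b := ramIdx F (finBelow F K w)
  rw [hl] at h
  have hss : s ^ 2 ≤ s ^ 2 * q := Nat.le_mul_of_pos_right _ hq
  have h' : s * s ≤ 4 * s * b + 2 * b + 1 := by nlinarith
  by_contra hc
  rw [not_le] at hc
  have h3 : (4 * b + 1) * s ≤ s * s := Nat.mul_le_mul_right s hc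
  nlinarith

/-- **Hence `l ≤ 8·e(v|p) + 1`** (`l = 2l⋆ + 1`): at genuine `K`-level data the inhabited one-factor locus is EMPTY whenever
`l > 8·e(v|p) + 1` at some bad place `v` of `F`. [cite: Mochizuki2012, IUTchI Def. 3.1 (c) p. 62] [cite: DupuyHilado2025, §3.3, §3.4] -/
theorem l_le_of_degree_window_pilotDataOfK {w : HeightOneSpectrum (𝓞 K)} (hS : w ∈ (pilotDataOfK D K).S)
    (hdeg : (((pilotDataOfK D K).lstar : ℕ) : ℝ) ^ 2 * (pilotDataOfK D K).qPilot w < (ramIdx K w : ℝ) + 1) :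
    l ≤ 8 * ramIdx F (finBelow F K w) + 1 := by
  have h := lstar_le_four_mul_ramIdx_of_degree_window_pilotDataOfK D hS hdeg
  have hl : l = 2 * (pilotDataOfK D K).lstar + 1 := (pilotDataOfK D K).l_eq
  omega

/-- **Hence `l ≤ 8·[F : ℚ] + 1`** (`e(v|p) ≤ [F : ℚ]`, abc-iut-S1's `ramificationIdx_int_le_finrank_rat`).
[cite: NeukirchANT1999, Ch. I §8 Prop. (8.2)] -/
theorem l_le_finrank_of_degree_window_pilotDataOfK {w : HeightOneSpectrum (𝓞 K)} (hS : w ∈ (pilotDataOfK D K).S)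
    (hdeg : (((pilotDataOfK D K).lstar : ℕ) : ℝ) ^ 2 * (pilotDataOfK D K).qPilot w < (ramIdx K w : ℝ) + 1) :
    l ≤ 8 * Module.finrank ℚ F + 1 := by
  have h := l_le_of_degree_window_pilotDataOfK D hS hdeg
  have hF : ramIdx F (finBelow F K w) ≤ Module.finrank ℚ F := by
    rw [ramIdx_eq F (finBelow F K w)]
    exact ramificationIdx_int_le_finrank_rat (finBelow F K w)
  omega

/-- **EXACT INTEGER DICTIONARY of the degree-window clause at genuine data**: `(l⋆)²·P_q(w) < e_w + 1` ⟺
`(l⋆)²·(e(w|v)·ord_v(q_v)) < 2l·(e(v|p)·e(w|v) + 1)` — so whether a given collection of initial Θ-data meets the inhabited locus at `w`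
is decided by the four integers `l`, `e(w|v)`, `e(v|p)`, `ord_v(q_v)` (e.g. `l = 5`, `e(v|p) = 1`, `e(w|v) = 5`, `ord_v(q_v) = 2`:
`4·10 = 40 < 10·6 = 60` ✓; `l = 7`, `e(v|p) = 1`, `e(w|v) = 7`, `ord_v(q_v) = 2`: `9·14 = 126 < 14·8 = 112` ✗). Nothing here asserts that
such data exist. [cite: DupuyHilado2025, §3.3, §3.4] [cite: Mochizuki2012, IUTchI Def. 3.1 (c) p. 62] -/
theorem degree_window_pilotDataOfK_iff {w : HeightOneSpectrum (𝓞 K)} (hS : w ∈ (pilotDataOfK D K).S) :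
    (((pilotDataOfK D K).lstar : ℕ) : ℝ) ^ 2 * (pilotDataOfK D K).qPilot w < (ramIdx K w : ℝ) + 1 ↔
      (pilotDataOfK D K).lstar ^ 2 * ((finBelow F K w).asIdeal.ramificationIdx' w.asIdeal * qParamOrd E (finBelow F K w)) <
        2 * l * (ramIdx F (finBelow F K w) * (finBelow F K w).asIdeal.ramificationIdx' w.asIdeal + 1) := by
  rw [qPilot_pilotDataOfK_eq D hS, ramIdx_eq_ramIdx_finBelow_mul (F := F) w]
  have h5 : 5 ≤ l := D.five_le_l
  have hl0 : (0 : ℝ) < 2 * (l : ℝ) := by positivity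
  rw [← mul_div_assoc, div_lt_iff₀' hl0]
  push_cast
  norm_cast

/-! ## §5. In the literal hypothesis shape of `licence_settingPrVolSharp_of_realises_shallow` -/

/-- **NECESSARY CONDITIONS FOR THE INHABITED TAME-SHALLOW LOCUS AT GENUINE `K`-LEVEL DATA.** With `X := pilotDataOfK D K` and the two
hypotheses `htame`, `hdeg` of `Thm311.Real.licence_settingPrVolSharp_of_realises_shallow` / `…exists_qPinned_and_hull_settingPrVolSharp_of_realises_shallow`
(p439445) VERBATIM: at every `w ∈ X.S`, with `v = w ∩ 𝓞_F`, `l + 2 ≤ p_w`, `(l⋆)²·ord_v(q_v) ≤ 2l·e(v|p) + 1`, `l ≤ 8·e(v|p) + 1` and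
`l ≤ 8·[F:ℚ] + 1`. (The `2 < p_v` and `1 ≤ P_q(v)` clauses are not used — the latter is automatic, `one_le_qPilot_pilotDataOfK`.)
[cite: Mochizuki2012, IUTchI Def. 3.1 (b),(c) pp. 61–62; Ex. 3.2 (iv) p. 71] [cite: DupuyHilado2025, §3.3, §3.4]
[claim: Mochizuki2012, status: disputed] -/
theorem genuine_necessary_of_shallow_locus_pilotDataOfK
    (htame : ∀ v ∈ (pilotDataOfK D K).S, 2 < residueChar K v ∧ ramIdx K v ≤ residueChar K v - 2)
    (hdeg : ∀ v ∈ (pilotDataOfK D K).S, 1 ≤ (pilotDataOfK D K).qPilot v ∧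
      (((pilotDataOfK D K).lstar : ℕ) : ℝ) ^ 2 * (pilotDataOfK D K).qPilot v < (ramIdx K v : ℝ) + 1)
    (w : HeightOneSpectrum (𝓞 K)) (hS : w ∈ (pilotDataOfK D K).S) :
    l + 2 ≤ residueChar K w ∧
      (pilotDataOfK D K).lstar ^ 2 * qParamOrd E (finBelow F K w) ≤ 2 * l * ramIdx F (finBelow F K w) + 1 ∧
      l ≤ 8 * ramIdx F (finBelow F K w) + 1 ∧ l ≤ 8 * Module.finrank ℚ F + 1 :=
  ⟨l_add_two_le_residueChar_of_tame_pilotDataOfK D hS (htame w hS).2,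
    lstar_sq_mul_qParamOrd_le_of_degree_window_pilotDataOfK D hS (hdeg w hS).2,
    l_le_of_degree_window_pilotDataOfK D hS (hdeg w hS).2,
    l_le_finrank_of_degree_window_pilotDataOfK D hS (hdeg w hS).2⟩

/-- **`F`-place form: on the inhabited locus, `l ≤ 8·e(v|p) + 1` at EVERY bad place `v ∈ 𝕍(F)^bad` of `F`** (every such `v` lies
under some prime `w` of `K`, `exists_finBelow_eq`, and that `w` is in `S`). [cite: Mochizuki2012, IUTchI Def. 3.1 (b),(c) pp. 61–62]
[cite: DupuyHilado2025, §3.3, §3.4] [claim: Mochizuki2012, status: disputed] -/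
theorem l_le_of_shallow_locus_pilotDataOfK_of_mem_VFbad
    (hdeg : ∀ v ∈ (pilotDataOfK D K).S, 1 ≤ (pilotDataOfK D K).qPilot v ∧
      (((pilotDataOfK D K).lstar : ℕ) : ℝ) ^ 2 * (pilotDataOfK D K).qPilot v < (ramIdx K v : ℝ) + 1)
    (v : HeightOneSpectrum (𝓞 F)) (hv : FinitePlace.mk v ∈ D.VFbad) :
    l ≤ 8 * ramIdx F v + 1 := by
  obtain ⟨w, hw⟩ := exists_finBelow_eq (L := K) v
  have hS : w ∈ (pilotDataOfK D K).S := (mem_pilotDataOfK_S_iff D K w).mpr (hw ▸ hv)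
  have h := l_le_of_degree_window_pilotDataOfK D hS (hdeg w hS).2
  rwa [hw] at h

end Summit.ABC.IUTFork.Cor312Prov

end
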